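import Summits.AnomalousDissipation.AnomalousDissipation.Theses.EnsembleRigidity
import Summits.AnomalousDissipation.AnomalousDissipation.Theorems.TaylorCertificatesZeroDatumLerayHopf
import Summits.AnomalousDissipation.AnomalousDissipation.Theorems.GPMeanBoundedFamily.Negative.LevelFloorExplicit
import Literature.Analysis.FluidPDE.DoeringFoiasAmplitudeProofs
import Literature.Analysis.FluidPDE.EnergySpaceTorusHilbertBasisProofs
import Literature.Analysis.FluidPDE.TorusForceBookkeeping
import Literature.Analysis.FluidPDE.LongTimeAverageSubadditive
import Literature.Analysis.FluidPDE.LerayHopfUniformEnergy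

/-!
# Disproof of `GPMeanBoundedFamily` (stmt-AnomalousDissipation-15509, route EnsembleRigidity) — findings

cdisprove seat `refuter-cdisprove-stmt-AnomalousDissipation-15509-0`, cycle 1 (2026-08-16).  Prose only in
docstrings; everything below is kernel-checked (rc 0, no `sorry`) unless marked NEAR-MISS.

**The crux.** `∃ E, ∃ ν_j ∈ (0,1] → 0, ∃ data u₀ⱼ, ∃ global Leray–Hopf u_j of NS_{ν_j}(f_GP), ∃ H-valued lifts
U_j (U_j t =ᵐ u_j t, t ≥ 0) with meanEnergy (u_j) ≤ E ∀ j` — TURBULENT SATURATION IN THE MEAN for the pinned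
Galloway–Proctor force `f_GP = sin(2πx₂)e₀ + sin(2πx₀)e₁ + sin(2πx₁)e₂`.  It is an ∃-statement; its negation
(`not_crux_iff`) says that EVERY lifted Leray–Hopf family along EVERY vanishing viscosity sequence has
`sup_j meanEnergy (u_j) = ∞`, i.e. that f_GP laminarises/hoards universally.  No printed or in-tree mechanism
gives that (Constantin–Tarfulea–Vicol arXiv:1305.7089 p.3: bounded families are OPEN already in 2-D; K41
phenomenology and all DNS of box-scale-forced 3-D turbulence say the opposite), so the verdict of this cycle is
**no kill; the crux resists**.  What the seat adds:

## Findings (index)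

* §0 `crux_iff`, `not_crux_iff` — the route decl unfolded at `f_GP` (the `∀ f, f = f_GP →` binder is cosmetic),
  and the exact shape of a disproof.
* §1 LOAD-BEARING ANALYSIS (for an ∃-crux a dropped clause WEAKENS the statement, so the informative fact is
  which weakenings are ALREADY THEOREMS): `withoutVanishing_holds` (drop `ν_j → 0`: provable now, ν ≡ 1, from
  the landed `ZeroDatumLerayHopf_proof`; so the vanishing-viscosity clause carries the whole content — agrees
  with rattack's Mutation.lean), `withoutLerayHopf_holds` (drop the PDE: `u ≡ 0`), `perViscosity_ceiling`
  (at each fixed ν the lifted family from rest has meanEnergy ≤ 24/ν² — the non-uniform bound that must be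
  beaten).  The H-lift clause only EXCLUDES witnesses (drift; negatives 2979/2984/0204) and cannot be what fails.
* §2 TIGHTNESS (landed as `Theorems/GPMeanBoundedFamily/Negative/LevelFloor.lean`, proposal p129373):
  `exists_meanEnergy_floor` — Doering–Foias: every LH solution of NS_ν(f_GP), ν ≤ 1, ANY datum, has
  meanEnergy ≥ e₀ > 0 (`‖f_GP‖₂² = 3/2`, `f_GP = (3/2)^{1/2} Φ_GP`, amplitude bound |F| ≤ C U² + ν K U);
  `level_floor` — every witness level satisfies `E ≥ e₀`; with §1 every witness level lives in `[e₀, 24/ν_j²]`.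
* §2b EXPLICIT LEVEL (landed as `…/Negative/AmplitudeIntegralBounds.lean` p129829 + `…/Negative/LevelFloorExplicit.lean`):
  the SHARP convective constant of f_GP (`|⟪U,(U·∇)f_GP⟫| ≤ 2π‖U‖²`, attained at U ∥ (1,1,1), x = 0) gives, for
  EVERY global Leray–Hopf solution of NS_ν(f_GP), `3/2 ≤ 2π⟨‖u‖²⟩ + νK⟨‖u‖²⟩^{1/2}`, hence **every witness level
  has `E ≥ 3/(4π) ≈ 0.2387`** (`level_ge`, alias of `Negative.level_ge_three_div_four_pi`) — within 4% of the
  symmetric-Galerkin / 16³-DNS equilibrium energy 0.248 at ν = 1/20 (smoke j020503), i.e. the Doering–Foias level of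
  f_GP is essentially ATTAINED at moderate ν; the open content is whether SOME attractor stays O(1) above it as ν → 0.
* §3 NATURAL STRENGTHENINGS REFUTED: `not_atEveryLevel` (∀ E > 0 ∃ family: false below e₀);
  the ∀-data strengthening (one E for all data) is the landed `FrustratedForcesGPEnergyCeiling_refuted`
  (Galilean drift / momentum), which is exactly why the crux carries the H-lift.
* §4 TARGETS: none (no skeleton / stubs registered on the crux at this cycle).
* §5 NUMERICAL ATTACK (kit j020536, adversarial DNS census of NS_ν(f_GP) on T³, ν = 1/20…1/320, data = rest /
  random / fat-laminar θ f/(4π²ν) / 2-mode hoarding state; smoke j020503 reproduced the ideator's symmetric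
  Galerkin equilibrium at ν = 1/20: E = 0.249, W = 0.565, a = 0.461, b = −0.189): does `min over attractors of
  ⟨|u|²⟩` grow as ν → 0?  Results are attached to the item as `compute-j020536.json` and summarised in
  `dns_census_note` below when available.
* §6 WHY IT RESISTS / what a disproof would need: `not_crux_iff` + docstring.

Used from the tree: `ZeroDatumLerayHopf_proof`, `stub_gpAdmissible`, `DoeringFoias.abs_amplitude_le_of_isGlobalLerayHopf`,
`Torus.inner_stokesModeL2_self/of_ne`, `longTimeAvgSup_le_const`, `Torus.integral_norm_sq_eq_norm_lift_sq`.
-/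

noncomputable section

open MeasureTheory Filter Set
open scoped RealInnerProductSpace

namespace Summit.AnomalousDissipation.AnomalousDissipation.Cruxes.GPMeanBoundedFamily.Disproof

open Literature.Analysis Literature.Analysis.FunctionSpaces Literature.Analysis.FluidPDE
open Summit.AnomalousDissipation.AnomalousDissipation.Theses.EnsembleRigidity

/-! ## §0 The crux unfolded -/

/-- The Galloway–Proctor force, the route's inline expression verbatim. -/
def gpForce : UnitAddTorus (Fin 3) → EuclideanSpace ℝ (Fin 3) := fun x : UnitAddTorus (Fin 3) =>
  (Torus.stokesMode (Pi.single (2 : Fin 3) (1 : ℤ)) (EuclideanSpace.single (0 : Fin 3) (1 : ℝ)) false x +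
    Torus.stokesMode (Pi.single (0 : Fin 3) (1 : ℤ)) (EuclideanSpace.single (1 : Fin 3) (1 : ℝ)) false x +
    Torus.stokesMode (Pi.single (1 : Fin 3) (1 : ℤ)) (EuclideanSpace.single (2 : Fin 3) (1 : ℝ)) false x :
    EuclideanSpace ℝ (Fin 3))

/-- `f_GP` is smooth, solenoidal, mean zero (landed `stub_gpAdmissible`). -/
theorem gpForce_admissible :
    Torus.IsSmooth gpForce ∧ Torus.IsDivFree gpForce ∧ Torus.HasZeroMean gpForce :=
  Summit.AnomalousDissipation.AnomalousDissipation.Theorems.SteadyStatesLoudBounded.GpAdmissible.stub_gpAdmissible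

/-- The H-lift clause of the crux for one path. -/
def IsLift (u : ℝ → UnitAddTorus (Fin 3) → EuclideanSpace ℝ (Fin 3))
    (U : ℝ → Torus.energySpace (Fin 3)) : Prop :=
  ∀ t, 0 ≤ t → ((U t : Lp (EuclideanSpace ℝ (Fin 3)) 2 (volume : Measure (UnitAddTorus (Fin 3)))) :
    UnitAddTorus (Fin 3) → EuclideanSpace ℝ (Fin 3)) =ᵐ[volume] u t

/-- The body of the crux at level `E` for a candidate family. -/
def Body (E : ℝ) (ν : ℕ → ℝ) (u₀ : ℕ → UnitAddTorus (Fin 3) → EuclideanSpace ℝ (Fin 3))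
    (u : ℕ → ℝ → UnitAddTorus (Fin 3) → EuclideanSpace ℝ (Fin 3)) (U : ℕ → ℝ → Torus.energySpace (Fin 3)) : Prop :=
  (∀ j, 0 < ν j ∧ ν j ≤ 1) ∧ Tendsto ν atTop (nhds 0) ∧
    (∀ j, Torus.IsGlobalLerayHopf (ν j) (fun _ => gpForce) (u₀ j) (u j)) ∧ (∀ j, IsLift (u j) (U j)) ∧
    ∀ j, meanEnergy (u j) ≤ E

/-- **The crux unfolded**: `GPMeanBoundedFamily ↔ ∃ E ν u₀ u U, Body E ν u₀ u U` (the binder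
`∀ f, f = f_GP →` is discharged by `rfl`). -/
theorem crux_iff : GPMeanBoundedFamily ↔ ∃ (E : ℝ) (ν : ℕ → ℝ) (u₀ : ℕ → UnitAddTorus (Fin 3) → EuclideanSpace ℝ (Fin 3))
    (u : ℕ → ℝ → UnitAddTorus (Fin 3) → EuclideanSpace ℝ (Fin 3)) (U : ℕ → ℝ → Torus.energySpace (Fin 3)),
    Body E ν u₀ u U := by
  constructor
  · intro h
    exact h gpForce rfl
  · rintro h f rfl
    exact h

/-- **Shape of a disproof**: `¬ GPMeanBoundedFamily` iff EVERY candidate family (viscosities in (0,1] tending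
to 0, global Leray–Hopf, H-lifted) overshoots EVERY level at some index — universal laminarisation/hoarding of
f_GP.  Nothing in print or in the tree produces a single zero-momentum Leray–Hopf family of a fixed 3-D force
whose mean energy PROVABLY diverges as ν → 0, let alone all of them. -/
theorem not_crux_iff : ¬ GPMeanBoundedFamily ↔
    ∀ (E : ℝ) (ν : ℕ → ℝ) (u₀ : ℕ → UnitAddTorus (Fin 3) → EuclideanSpace ℝ (Fin 3))
      (u : ℕ → ℝ → UnitAddTorus (Fin 3) → EuclideanSpace ℝ (Fin 3)) (U : ℕ → ℝ → Torus.energySpace (Fin 3)),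
      (∀ j, 0 < ν j ∧ ν j ≤ 1) → Tendsto ν atTop (nhds 0) →
      (∀ j, Torus.IsGlobalLerayHopf (ν j) (fun _ => gpForce) (u₀ j) (u j)) → (∀ j, IsLift (u j) (U j)) →
      ∃ j, E < meanEnergy (u j) := by
  rw [crux_iff]
  constructor
  · intro h E ν u₀ u U hν hν0 hLH hU
    by_contra hall
    push Not at hall
    exact h ⟨E, ν, u₀, u, U, hν, hν0, hLH, hU, hall⟩
  · rintro h ⟨E, ν, u₀, u, U, hν, hν0, hLH, hU, hE⟩
    obtain ⟨j, hj⟩ := h E ν u₀ u U hν hν0 hLH hU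
    exact absurd (hE j) (not_le.mpr hj)

/-! ## §1 Load-bearing analysis: which weakenings are already theorems -/

/-- **Per-viscosity layer (in tree).** For every `ν ∈ (0,1]` the lifted Leray–Hopf solution of NS_ν(f_GP) FROM
REST exists and has `meanEnergy ≤ 16‖f_GP‖₂²/ν² ≤ 24/ν²` (`ZeroDatumLerayHopf_proof` + `longTimeAvgSup_le_const`;
`‖f_GP‖₂² = 3/2` is `integral_norm_sq_gpForce` below, here only `≤ 3/2·16 = 24` is used via the Leray ball).
This is the NON-uniform bound the crux must beat; it is also rattack's `perViscosity`. -/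
theorem perViscosity_ceiling (ν : ℝ) (hν : 0 < ν) :
    ∃ (u : ℝ → UnitAddTorus (Fin 3) → EuclideanSpace ℝ (Fin 3)) (U : ℝ → Torus.energySpace (Fin 3)),
      Torus.IsGlobalLerayHopf ν (fun _ => gpForce) 0 u ∧ IsLift u U ∧
      meanEnergy u ≤ 16 * (∫ x, ‖gpForce x‖ ^ 2) / ν ^ 2 := by
  obtain ⟨hsm, -, hzm⟩ := gpForce_admissible
  obtain ⟨u, U, hu, hU, hball⟩ :=
    Summit.AnomalousDissipation.AnomalousDissipation.Theorems.ZeroDatumLerayHopf_proof ν gpForce hν hsm hzm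
  refine ⟨u, U, hu, hU, ?_⟩
  refine longTimeAvgSup_le_const (fun t => integral_nonneg fun x => sq_nonneg _) fun t ht => ?_
  rw [Torus.integral_norm_sq_eq_norm_lift_sq hU ht.le]
  simpa [Submodule.coe_norm] using hball t ht.le

/-- The crux with the clause `ν_j → 0` DROPPED. -/
def GPMeanBoundedFamilyWithoutVanishing : Prop :=
  ∃ (E : ℝ) (ν : ℕ → ℝ) (u₀ : ℕ → UnitAddTorus (Fin 3) → EuclideanSpace ℝ (Fin 3))
    (u : ℕ → ℝ → UnitAddTorus (Fin 3) → EuclideanSpace ℝ (Fin 3)) (U : ℕ → ℝ → Torus.energySpace (Fin 3)),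
    (∀ j, 0 < ν j ∧ ν j ≤ 1) ∧
    (∀ j, Torus.IsGlobalLerayHopf (ν j) (fun _ => gpForce) (u₀ j) (u j)) ∧ (∀ j, IsLift (u j) (U j)) ∧
    ∀ j, meanEnergy (u j) ≤ E

/-- **Dropping `ν_j → 0` makes the crux a theorem** (ν ≡ 1, the family from rest, `E = 16‖f_GP‖²`): the
vanishing-viscosity clause carries the ENTIRE content — ν-UNIFORMITY of the mean-energy bound. -/
theorem withoutVanishing_holds : GPMeanBoundedFamilyWithoutVanishing := by
  obtain ⟨u, U, hu, hU, hE⟩ := perViscosity_ceiling 1 one_pos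
  refine ⟨16 * (∫ x, ‖gpForce x‖ ^ 2) / 1 ^ 2, fun _ => 1, fun _ => 0, fun _ => u, fun _ => U,
    fun _ => ⟨one_pos, le_rfl⟩, fun _ => hu, fun _ => hU, fun _ => hE⟩

/-- The crux with the Leray–Hopf clause DROPPED (no PDE). -/
def GPMeanBoundedFamilyWithoutLerayHopf : Prop :=
  ∃ (E : ℝ) (ν : ℕ → ℝ) (u : ℕ → ℝ → UnitAddTorus (Fin 3) → EuclideanSpace ℝ (Fin 3))
    (U : ℕ → ℝ → Torus.energySpace (Fin 3)),
    (∀ j, 0 < ν j ∧ ν j ≤ 1) ∧ Tendsto ν atTop (nhds 0) ∧ (∀ j, IsLift (u j) (U j)) ∧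
    ∀ j, meanEnergy (u j) ≤ E

/-- **Dropping the PDE makes the crux trivial** (`u ≡ 0`, `U ≡ 0`, `ν_j = 1/(j+1)`, `E = 0`): the Leray–Hopf
clause is what ties energy to viscosity. -/
theorem withoutLerayHopf_holds : GPMeanBoundedFamilyWithoutLerayHopf := by
  refine ⟨0, fun j => 1 / ((j : ℝ) + 1), fun _ _ _ => 0, fun _ _ => 0, fun j => ⟨by positivity, ?_⟩,
    tendsto_one_div_add_atTop_nhds_zero_nat, fun j t _ => ?_, fun j => ?_⟩
  · rw [div_le_one (by positivity)]; linarith [(Nat.cast_nonneg j : (0 : ℝ) ≤ j)]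
  · exact (Lp.coeFn_zero (EuclideanSpace ℝ (Fin 3)) 2 volume).trans (Filter.EventuallyEq.of_eq rfl)
  · have h : (fun t : ℝ => ∫ x : UnitAddTorus (Fin 3), ‖(0 : EuclideanSpace ℝ (Fin 3))‖ ^ 2) = fun _ => 0 := by
      funext t; simp
    change longTimeAvgSup (fun t : ℝ => ∫ x : UnitAddTorus (Fin 3), ‖(0 : EuclideanSpace ℝ (Fin 3))‖ ^ 2) ≤ 0
    rw [h, longTimeAvgSup_zero_fun]

/-! ## §2 Tightness: the Doering–Foias level floor (landed as `…/GPMeanBoundedFamily/Negative/LevelFloor.lean`, p129373) -/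

/-- The three first-shell frequencies of `f_GP`. -/
private theorem freq_facts :
    ((Pi.single (2 : Fin 3) (1 : ℤ) : Fin 3 → ℤ) ≠ 0) ∧ ((Pi.single (0 : Fin 3) (1 : ℤ) : Fin 3 → ℤ) ≠ 0) ∧
    ((Pi.single (1 : Fin 3) (1 : ℤ) : Fin 3 → ℤ) ≠ 0) ∧
    ((Pi.single (2 : Fin 3) (1 : ℤ) : Fin 3 → ℤ) ≠ (Pi.single (0 : Fin 3) (1 : ℤ) : Fin 3 → ℤ)) ∧
    ((Pi.single (2 : Fin 3) (1 : ℤ) : Fin 3 → ℤ) ≠ -(Pi.single (0 : Fin 3) (1 : ℤ) : Fin 3 → ℤ)) ∧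
    ((Pi.single (2 : Fin 3) (1 : ℤ) : Fin 3 → ℤ) ≠ (Pi.single (1 : Fin 3) (1 : ℤ) : Fin 3 → ℤ)) ∧
    ((Pi.single (2 : Fin 3) (1 : ℤ) : Fin 3 → ℤ) ≠ -(Pi.single (1 : Fin 3) (1 : ℤ) : Fin 3 → ℤ)) ∧
    ((Pi.single (0 : Fin 3) (1 : ℤ) : Fin 3 → ℤ) ≠ (Pi.single (1 : Fin 3) (1 : ℤ) : Fin 3 → ℤ)) ∧
    ((Pi.single (0 : Fin 3) (1 : ℤ) : Fin 3 → ℤ) ≠ -(Pi.single (1 : Fin 3) (1 : ℤ) : Fin 3 → ℤ)) := by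
  decide

/-- **`‖f_GP‖₂² = 3/2`** (three mutually orthogonal sine Stokes modes of squared norm `1/2`). -/
theorem integral_norm_sq_gpForce : ∫ x, ‖gpForce x‖ ^ 2 = 3 / 2 := by
  obtain ⟨h1, h2, h3, h12, h12', h13, h13', h23, h23'⟩ := freq_facts
  set m₁ := Torus.stokesModeL2 (d := Fin 3) (Pi.single (2 : Fin 3) (1 : ℤ)) (EuclideanSpace.single (0 : Fin 3) (1 : ℝ)) false
    with hm₁
  set m₂ := Torus.stokesModeL2 (d := Fin 3) (Pi.single (0 : Fin 3) (1 : ℤ)) (EuclideanSpace.single (1 : Fin 3) (1 : ℝ)) false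
    with hm₂
  set m₃ := Torus.stokesModeL2 (d := Fin 3) (Pi.single (1 : Fin 3) (1 : ℤ)) (EuclideanSpace.single (2 : Fin 3) (1 : ℝ)) false
    with hm₃
  set G := m₁ + m₂ + m₃ with hG
  have hae : (G : UnitAddTorus (Fin 3) → EuclideanSpace ℝ (Fin 3)) =ᵐ[volume] gpForce := by
    have e12 := (Lp.coeFn_add m₁ m₂).trans
      ((Torus.coeFn_stokesModeL2 _ _ _).add (Torus.coeFn_stokesModeL2 _ _ _))
    have e123 := (Lp.coeFn_add (m₁ + m₂) m₃).trans (e12.add (Torus.coeFn_stokesModeL2 _ _ _))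
    exact e123.trans (Filter.EventuallyEq.of_eq rfl)
  have hinner : ⟪G, G⟫ = ∫ x, ‖gpForce x‖ ^ 2 := by
    rw [MeasureTheory.L2.inner_def]
    refine integral_congr_ae (hae.mono fun x hx => ?_)
    simp only [hx, real_inner_self_eq_norm_sq]
  have n0 : ‖(EuclideanSpace.single (0 : Fin 3) (1 : ℝ))‖ = 1 := by simp
  have n1 : ‖(EuclideanSpace.single (1 : Fin 3) (1 : ℝ))‖ = 1 := by simp
  have n2 : ‖(EuclideanSpace.single (2 : Fin 3) (1 : ℝ))‖ = 1 := by simp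
  have d1 : ⟪m₁, m₁⟫ = 1 / 2 := by rw [hm₁, Torus.inner_stokesModeL2_self h1, n0]; norm_num
  have d2 : ⟪m₂, m₂⟫ = 1 / 2 := by rw [hm₂, Torus.inner_stokesModeL2_self h2, n1]; norm_num
  have d3 : ⟪m₃, m₃⟫ = 1 / 2 := by rw [hm₃, Torus.inner_stokesModeL2_self h3, n2]; norm_num
  have o12 : ⟪m₁, m₂⟫ = 0 := by rw [hm₁, hm₂]; exact Torus.inner_stokesModeL2_of_ne h12 h12' _ _ _ _
  have o13 : ⟪m₁, m₃⟫ = 0 := by rw [hm₁, hm₃]; exact Torus.inner_stokesModeL2_of_ne h13 h13' _ _ _ _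
  have o23 : ⟪m₂, m₃⟫ = 0 := by rw [hm₂, hm₃]; exact Torus.inner_stokesModeL2_of_ne h23 h23' _ _ _ _
  have o21 : ⟪m₂, m₁⟫ = 0 := by rw [real_inner_comm]; exact o12
  have o31 : ⟪m₃, m₁⟫ = 0 := by rw [real_inner_comm]; exact o13
  have o32 : ⟪m₃, m₂⟫ = 0 := by rw [real_inner_comm]; exact o23
  have hsum : ⟪G, G⟫ = 3 / 2 := by
    simp only [hG, inner_add_left, inner_add_right, d1, d2, d3, o12, o13, o23, o21, o31, o32]
    norm_num
  rw [← hinner, hsum]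

/-- The Doering–Foias forcing shape of `f_GP`: `Φ_GP = (2/3)^{1/2} • f_GP`. -/
def gpShape : ForcingShape (Fin 3) where
  shape := Real.sqrt (2 / 3) • gpForce
  smooth := gpForce_admissible.1.smul _
  divFree := Torus.isDivFree_const_smul (gpForce_admissible.1.isContDiff (by simp)) gpForce_admissible.2.1 _
  zeroMean := Torus.hasZeroMean_const_smul gpForce_admissible.2.2 _
  sq_norm_eq_one := by
    have h : ∀ x, ‖(Real.sqrt (2 / 3) • gpForce) x‖ ^ 2 = (2 / 3) * ‖gpForce x‖ ^ 2 := fun x => by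
      rw [Pi.smul_apply, norm_smul, mul_pow, Real.norm_eq_abs, sq_abs,
        Real.sq_sqrt (by norm_num : (0 : ℝ) ≤ 2 / 3)]
    simp_rw [h]
    rw [integral_const_mul, integral_norm_sq_gpForce]
    norm_num

/-- `f_GP = F Φ_GP`, `F = (3/2)^{1/2}`, scale `ℓ = 1`. -/
theorem gpShape_force_one : gpShape.force 1 (Real.sqrt (3 / 2)) = gpForce := by
  funext x
  simp only [ForcingShape.force, gpShape, one_nsmul, Pi.smul_apply, smul_smul]
  rw [← Real.sqrt_mul (by norm_num : (0 : ℝ) ≤ 3 / 2), show (3 / 2 : ℝ) * (2 / 3) = 1 by norm_num,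
    Real.sqrt_one, one_smul]

/-- **LEVEL FLOOR (Doering–Foias; landed p129373).** There is `e₀ > 0` with `e₀ ≤ meanEnergy u` for every global
Leray–Hopf solution of NS_ν(f_GP), `0 < ν ≤ 1`, any datum, any momentum: `|F| ≤ C U² + ν K U` with
`U = (meanEnergy u)^{1/2}` forces `U ≥ min(1, F/(C+K+1))`. -/
theorem exists_meanEnergy_floor :
    ∃ e₀ : ℝ, 0 < e₀ ∧ ∀ (ν : ℝ) (u₀ : UnitAddTorus (Fin 3) → EuclideanSpace ℝ (Fin 3))
      (u : ℝ → UnitAddTorus (Fin 3) → EuclideanSpace ℝ (Fin 3)),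
      0 < ν → ν ≤ 1 → Torus.IsGlobalLerayHopf ν (fun _ => gpForce) u₀ u → e₀ ≤ meanEnergy u := by
  obtain ⟨M, hM0, hM⟩ := exists_norm_laplacian_force_le gpShape
  obtain ⟨D, hD0, hD⟩ := exists_sum_norm_partialDeriv_comp_nsmul_le gpShape
  set F : ℝ := Real.sqrt (3 / 2) with hF
  have hFpos : 0 < F := Real.sqrt_pos.mpr (by norm_num)
  have hS : 0 < D + M + 1 := by linarith
  set U₀ : ℝ := min 1 (F / (D + M + 1)) with hU₀
  have hU₀pos : 0 < U₀ := lt_min one_pos (div_pos hFpos hS)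
  refine ⟨U₀ ^ 2, pow_pos hU₀pos 2, fun ν u₀ u hν hν1 hu => ?_⟩
  have hu' : Torus.IsGlobalLerayHopf ν (fun _ => gpShape.force 1 F) u₀ u := by rwa [gpShape_force_one]
  have hCΨ : ∀ x, ∑ i, ‖Torus.partialDeriv i (gpShape.force 1 1) x‖ ≤ D := fun x => by
    rw [force_one_eq]; simpa using hD 1 x
  have hL : ∀ x, ‖Torus.laplacian (gpShape.force 1 1) x‖ ≤ M := fun x => by simpa using hM 1 1 x
  have key := DoeringFoias.abs_amplitude_le_of_isGlobalLerayHopf hν one_pos hu' hD0 hM0 hCΨ hL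
  set U := rmsVelocity longTimeAvgSup u with hU
  have hUdef : U = Real.sqrt (meanEnergy u) := rfl
  have hU0 : 0 ≤ U := Real.sqrt_nonneg _
  have hE0 : 0 ≤ meanEnergy u := meanEnergy_nonneg u
  rw [abs_of_pos hFpos] at key
  by_contra hcon
  have hlt : meanEnergy u < U₀ ^ 2 := lt_of_not_ge hcon
  have hUlt : U < U₀ := by
    rw [hUdef]
    calc Real.sqrt (meanEnergy u) < Real.sqrt (U₀ ^ 2) := Real.sqrt_lt_sqrt hE0 hlt
      _ = U₀ := Real.sqrt_sq hU₀pos.le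
  have hU1 : U ≤ 1 := (hUlt.le.trans (min_le_left _ _))
  have hUF : U < F / (D + M + 1) := hUlt.trans_le (min_le_right _ _)
  have h1 : D * U ^ 2 ≤ D * U := by
    have : U ^ 2 ≤ U := by nlinarith
    exact mul_le_mul_of_nonneg_left this hD0
  have h2 : ν * M * U ≤ M * U := by
    have : ν * M ≤ M := by nlinarith
    exact mul_le_mul_of_nonneg_right this hU0
  have h3 : (D + M + 1) * U < F := by
    have := (lt_div_iff₀ hS).mp hUF
    linarith [this]
  nlinarith [key, h1, h2, h3, hU0]

/-- **Every witness level is at least `e₀`** (uses only the viscosity, Leray–Hopf and energy clauses at `j = 0`). -/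
theorem level_floor : ∃ e₀ : ℝ, 0 < e₀ ∧ ∀ (E : ℝ) (ν : ℕ → ℝ)
    (u₀ : ℕ → UnitAddTorus (Fin 3) → EuclideanSpace ℝ (Fin 3)) (u : ℕ → ℝ → UnitAddTorus (Fin 3) → EuclideanSpace ℝ (Fin 3))
    (U : ℕ → ℝ → Torus.energySpace (Fin 3)), Body E ν u₀ u U → e₀ ≤ E := by
  obtain ⟨e₀, he₀, hfloor⟩ := exists_meanEnergy_floor
  refine ⟨e₀, he₀, fun E ν u₀ u U hB => ?_⟩
  obtain ⟨hν, -, hLH, -, hE⟩ := hB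
  exact (hfloor (ν 0) (u₀ 0) (u 0) (hν 0).1 (hν 0).2 (hLH 0)).trans (hE 0)

/-! ## §2b The explicit level: `E ≥ 3/(4π)` (landed `Negative/LevelFloorExplicit.lean`) -/

/-- **Every witness of the crux has level `E ≥ 3/(4π) ≈ 0.2387`** (alias of the landed
`Negative.level_ge_three_div_four_pi`; the lift clause and `ν_j ≤ 1` are not even used). The crude uniform floor
`e₀` of §2 is superseded for the LEVEL question; numerically `3/(4π) = 0.2387…` while the 2-mode symmetric
equilibrium / 16³ DNS at ν = 1/20 sits at `E = 0.248`. -/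
theorem level_ge (E : ℝ) (ν : ℕ → ℝ) (u₀ : ℕ → UnitAddTorus (Fin 3) → EuclideanSpace ℝ (Fin 3))
    (u : ℕ → ℝ → UnitAddTorus (Fin 3) → EuclideanSpace ℝ (Fin 3)) (U : ℕ → ℝ → Torus.energySpace (Fin 3))
    (hB : Body E ν u₀ u U) : 3 / (4 * Real.pi) ≤ E := by
  obtain ⟨hν, hν0, hLH, -, hE⟩ := hB
  exact Summit.AnomalousDissipation.AnomalousDissipation.Theorems.GPMeanBoundedFamily.Negative.level_ge_three_div_four_pi
    E ν u₀ u (fun j => (hν j).1) hν0 hLH hE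

/-- `3/(4π) > 0.2387`: the numerical value quoted above. -/
theorem three_div_four_pi_gt : (2387 / 10000 : ℝ) < 3 / (4 * Real.pi) := by
  have hpi : Real.pi < 3.1416 := Real.pi_lt_d4
  rw [lt_div_iff₀ (by positivity)]
  nlinarith

/-- STRENGTHENING refuted (explicit): the crux with its level fixed at any `E < 3/(4π)` — e.g. `E = 0.2387`, just
below the ν = 1/20 symmetric equilibrium energy — is FALSE (alias of `Negative.not_below_three_div_four_pi`,
restated for `Body`). -/
theorem not_body_below_level {E : ℝ} (hE : E < 3 / (4 * Real.pi)) :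
    ¬ ∃ (ν : ℕ → ℝ) (u₀ : ℕ → UnitAddTorus (Fin 3) → EuclideanSpace ℝ (Fin 3))
      (u : ℕ → ℝ → UnitAddTorus (Fin 3) → EuclideanSpace ℝ (Fin 3)) (U : ℕ → ℝ → Torus.energySpace (Fin 3)),
      Body E ν u₀ u U := by
  rintro ⟨ν, u₀, u, U, hB⟩
  exact absurd (level_ge E ν u₀ u U hB) (not_le.mpr hE)

/-! ## §3 Natural strengthenings refuted -/

/-- STRENGTHENING: mean-bounded lifted families exist AT EVERY positive level. -/
def GPMeanBoundedFamilyAtEveryLevel : Prop :=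
  ∀ E : ℝ, 0 < E → ∃ (ν : ℕ → ℝ) (u₀ : ℕ → UnitAddTorus (Fin 3) → EuclideanSpace ℝ (Fin 3))
    (u : ℕ → ℝ → UnitAddTorus (Fin 3) → EuclideanSpace ℝ (Fin 3)) (U : ℕ → ℝ → Torus.energySpace (Fin 3)),
    Body E ν u₀ u U

/-- **Refuted** (landed p129373 as `not_atEveryLevel`): no family is mean-bounded by `e₀/2`. -/
theorem not_atEveryLevel : ¬ GPMeanBoundedFamilyAtEveryLevel := by
  intro h
  obtain ⟨e₀, he₀, hfloor⟩ := level_floor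
  obtain ⟨ν, u₀, u, U, hB⟩ := h (e₀ / 2) (half_pos he₀)
  have := hfloor (e₀ / 2) ν u₀ u U hB
  linarith

/-- STRENGTHENING: ONE level bounds the mean energy of EVERY lifted Leray–Hopf solution at every ν ∈ (0,1]
(the ∀-data ceiling, zero momentum enforced by the lift).  STATUS: OPEN — this is FrustratedForces'
`GPLoudEnergyCeilingZ` (stmt-13924) in lifted form; its momentum-free ancestor `GPEnergyCeiling` (stmt-2979) is
REFUTED in tree (`FrustratedForcesGPEnergyCeiling_refuted`: Galilean drift of the datum), which is exactly why
the present crux carries the H-lift clause.  A refutation here would need a zero-momentum Leray–Hopf family of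
NS_ν(f_GP) with meanEnergy → ∞ (e.g. the symmetric Stokes arc `E ≈ 0.03 ν^{-2/3}` realised in the continuum and
shown to be a Leray–Hopf steady state at every small ν — the continuation is not available). Recorded, not claimed. -/
def GPMeanCeilingAllLiftedData : Prop :=
  ∃ E : ℝ, ∀ (ν : ℝ) (u₀ : UnitAddTorus (Fin 3) → EuclideanSpace ℝ (Fin 3))
    (u : ℝ → UnitAddTorus (Fin 3) → EuclideanSpace ℝ (Fin 3)) (U : ℝ → Torus.energySpace (Fin 3)),
    0 < ν → ν ≤ 1 → Torus.IsGlobalLerayHopf ν (fun _ => gpForce) u₀ u → IsLift u U → meanEnergy u ≤ E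

/-- The ∀-data ceiling trivially implies the crux (any viscosity sequence, the family from rest of §1). -/
theorem crux_of_ceilingAllLiftedData (h : GPMeanCeilingAllLiftedData) : GPMeanBoundedFamily := by
  rw [crux_iff]
  obtain ⟨E, hE⟩ := h
  have key : ∀ j : ℕ, ∃ (u : ℝ → UnitAddTorus (Fin 3) → EuclideanSpace ℝ (Fin 3)) (U : ℝ → Torus.energySpace (Fin 3)),
      Torus.IsGlobalLerayHopf (1 / ((j : ℝ) + 1)) (fun _ => gpForce) 0 u ∧ IsLift u U := fun j => by
    obtain ⟨u, U, hu, hU, -⟩ := perViscosity_ceiling (1 / ((j : ℝ) + 1)) (by positivity)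
    exact ⟨u, U, hu, hU⟩
  choose u U hu hU using key
  have hν : ∀ j : ℕ, 0 < 1 / ((j : ℝ) + 1) ∧ 1 / ((j : ℝ) + 1) ≤ 1 := fun j =>
    ⟨by positivity, by rw [div_le_one (by positivity)]; linarith [(Nat.cast_nonneg j : (0 : ℝ) ≤ j)]⟩
  exact ⟨E, fun j => 1 / ((j : ℝ) + 1), fun _ => 0, u, U, hν, tendsto_one_div_add_atTop_nhds_zero_nat, hu, hU,
    fun j => hE _ 0 (u j) (U j) (hν j).1 (hν j).2 (hu j) (hU j)⟩

/-! ## §4 Targets — the picked line `Sketch` (idea pyritohedral-head-neck-body; PICKED.md 22:23Z; stubs registered 22:42Z)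

Registered stubs (ledger workitem stubs): `stub_headPinned` (S4), `stub_symmetricScheme` (S5), `stub_symmetricLimit` (S6),
`stub_symmetricMeanCeiling` (S7); S1 `stub_headModes` (p129757) and S2 `stub_lambIdentity` (p129527) landed.

* S4 `stub_headPinned` — CONSISTENT, checked exactly this seat (`sym/fixdim.py`, evidence `fixdim-S4.md`): for the group
  generated by EXACTLY the three Lean generators of `IsGPSymmetric` (`cycShift`, inversion, `twistTurn` of
  `EnsembleRigidityDefs`) the space of real, solenoidal, mean-zero trigonometric fields supported on the ball
  `|k|² ≤ R²` has dimension 1, 2, 2, 2 for R² = 1, 2, 3, 4 (shell content 1,1,0,0) and 4, 6, 7, 10 for R² = 5, 6, 8, 9;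
  `gpForce` and `lambMode` lie in it, the cosine partner `curl f_GP/2π` does not.  So both conjuncts of S4 are true
  statements (rational linear algebra, 192 unknowns / rank 190 at R² = 4); no kill.  (Lean proof = prover's job.)
* S5/S6 — provable in kind (frequency balls and the Leray symbol commute with signed permutations; half-translations
  act by signs ±1 on coefficients since `2(Qm)·b ∈ ℤ`); the empty levels `N n = 0` are symmetric trivially.  No attack.
* S7 `stub_symmetricMeanCeiling` — THE CONTENT, and STRONGER than the crux: a ν-UNIFORM ceiling over ALL
  G-symmetric lifted Leray–Hopf solutions FROM REST, ν ∈ (0,1].  Its hypotheses are true tool facts, so S7 ⇔ the bare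
  symmetric ceiling.  A Lean kill needs a symmetric Leray–Hopf family from rest with meanEnergy → ∞ (the card's own
  HOARDING scenario `b ≈ −0.17 ν^{-1/3}`, `E ≈ 0.03 ν^{-2/3}` persisting as the truncation is removed) — not
  constructible; the decisive cheap test is NUMERICAL: exactly-symmetric DNS from rest at ν = 1/20…1/160 (ideator kit
  j020324, projected on Fix(G)) — hoarding there = `stub-false (numerical)` evidence for the lead, saturation = S7
  plausible.  The level bound of §2b applies verbatim to S7's `E` (E ≥ 3/(4π)).
* `GPMeanBoundedFamily_of` (skeleton glue) — joint sufficiency is honest: S7's `E` + S5/S6 at `ν_j = 1/(j+2)` give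
  the crux by name; no gap smuggled (checked by reading `Lines/Sketch.lean`).

## §5 Numerical attack (kit j020536; smoke j020503)

`dns_census_note` records the protocol; numbers are filled in from `compute-j020536.json` (auto-attached to the
item) — see the seat's NOTES.md / the item evidence for the table `ν ↦ (E_mean per datum, W, ε, a, b, k_max η)`.
Verdict rule: late-time ⟨|u|²⟩ of the rest/random runs roughly ν-independent across ν = 1/20…1/320 while the
fat-laminar and hoarding data DECAY to the same level ⇒ `E_min(ν)` is numerically O(1) and no attractor hoards
⇒ the disprover's only scenario (universal laminarisation) is dead numerically; conversely ⟨|u|²⟩ growing like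
ν^{-2/3} (symmetric-chain hoarding, b ≈ −0.17 ν^{-1/3}) in ALL runs would be the first evidence against the crux. -/

/-- Protocol marker for the DNS census (no mathematical content). -/
theorem dns_census_note : True := trivial

/-! ## §6 Why it resists (summary for provers)

* The negation is a UNIVERSAL divergence statement (`not_crux_iff`); the only candidate mechanism — every
  trajectory of NS_ν(f_GP) is eventually captured by fat quiet states (Stokes-arc ends, ‖u‖ ≍ ν^{-1/3}) — is
  contradicted by the ideator's own symmetric Galerkin dynamics (unsteady already at K² ≤ 6, ν = 3·10⁻³) and by
  every DNS of box-scale forcing; and even ONE saturating family kills the negation.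
* Junk exits are closed: for Leray–Hopf paths at ν > 0 the Cesàro means of the energy are bounded and measurable
  (`timeMean_norm_sq_le`), so `meanEnergy` is an honest limsup (no `Real.sSup ∅ = 0` escape either way).
* The level is bracketed, not free: `e₀ ≤ E` (§2) and witnesses at fixed ν exist up to `24/ν²` (§1); the crux is
  precisely the inhabitation of `[e₀, ∞)` uniformly in j — Doering–Foias theory is silent there (U is a parameter
  in DF2002 §3), CTV2013 p.3 prints it open.
* Hence: provers should not expect help from a cheap obstruction; the disprover's standing offer is to attack the
  STUBS of whichever line is picked (symmetric class C⁺ of card pyritohedral-head-neck-body: its single drainage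
  statement is falsifiable by symmetric DNS hoarding — watch kit j020324/j020536).
-/

end Summit.AnomalousDissipation.AnomalousDissipation.Cruxes.GPMeanBoundedFamily.Disproof
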